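import Summits.CriticalPhenomena.PercolationContinuityZ3.Theorems.PercNearOneGluingNoHeavyLowerTailSahiCTCC2ThreeSliceS
import Summits.CriticalPhenomena.PercolationContinuityZ3.Theorems.PercNearOneGluingNoHeavyLowerTailSahiCTCRtBigNested
import HarnessLib

/-!
# `NoHeavyLowerTail` (crux stmt-CriticalPhenomena-4575), P3 lane: LOOP POINTS PEEL UPWARD in the level-3 monotonicity C2 —
# at a vertex `s` with `{s} ∈ 𝒳` (a loop of one family) the `[x_s¹] − [x_s²]` slice of the C2 difference of `R_3` equals its `[x_s⁰]` slice plus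
# manifestly nonnegative terms; so a single point of the profile that is a loop can be DOUBLED (row `q` → row `q+1`)

Support file (seat `prim-l12-p3`, gen 43; `--supports stmt-CriticalPhenomena-4575`).  Memo
`run/shared/lean/prim/prim-l12/FROM-prim-l12-p3-g43-C2-LEVEL-THREE.md` §9.5.  With `P = RlumpVx D 𝒳 𝒵 v 2 − RlumpVx D 𝒳 𝒵 v 3` (`D = {#S<3}`, the C2
difference of `R_3` at `v`) and a vertex `s ≠ v` with `{s} ∈ 𝒳`:
* the loop substitutions (`linkV_delV_of_loop`, …): every `s`-link of an `𝒳`-object is "full", the `s`-links of the common families are the `s`-links of the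
  `𝒵`-objects, the size families shift;
* **`loopPeel_identity`** : for `s`-free `n`,
    `P.coeff (n+e_s) − P.coeff (n+2e_s) = P.coeff n + coeff_n( e₁''·((Π''−X¹⁰)(Z⁰¹−Z⁰⁰) + (X¹⁰−X⁰⁰)(Z¹¹−Z¹⁰)) + e₂''·(Π''−X¹⁰)(Z¹¹−Z¹⁰) )`
  (double sections `X^{ab}`, `a = [v ∈]`, `b = [s ∈]`; `…C2ThreeSliceS.loopPeel_ring` after the substitutions — lab/y22, y24 of the memo), hence
* **`coeff_C2three_loopPeel`** : `P.coeff (n + 2e_s) + P.coeff n ≤ P.coeff (n + e_s)`, and the `R_3` form **`coeff_Rt_three_C2_loopPeel`** (and `'` for a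
  loop of `𝒵`): for `m_v = 2`, `m_s = 1`, `{s} ∈ 𝒳`:  `C2diff(m + e_s) + C2diff(m − e_s) ≤ C2diff(m)` where `C2diff(m) = coeff_m R_3 − coeff_{m+e_v} R_3`.
So in every row of the level-3 C2 problem a single point that is a loop of either family can be moved to the doubled set at the cost of the same row
with one single point less (row 3 is a theorem, `…SahiCTCC2ThreeReduction`): loops never obstruct C2 at level 3.  Nothing is asserted about the crux.
-/

noncomputable section

open scoped Classical

namespace Summit.CriticalPhenomena.PercolationContinuityZ3.Theorems.SahiCTCForms

open Finset MvPolynomial SahiCTCGenFun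

variable {α : Type*} [DecidableEq α] [Fintype α]


/-! ### The loop substitutions -/

section Loop
variable {F G : Finset (Finset α)} {s v : α}

omit [Fintype α] in
/-- Members of a double deletion. [this work] -/
theorem mem_delV_delV {K : Finset (Finset α)} {S : Finset α} : S ∈ delV s (delV v K) ↔ (S ∈ K ∧ v ∉ S) ∧ s ∉ S := by
  unfold delV; rw [mem_filter, mem_filter]

/-- Members of the `s`-deletion of a `v`-link. [this work] -/
theorem mem_delV_linkV {K : Finset (Finset α)} {S : Finset α} : S ∈ delV s (linkV v K) ↔ (v ∉ S ∧ insert v S ∈ K) ∧ s ∉ S := by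
  unfold delV linkV; rw [mem_filter, mem_filter, mem_powerset, subset_erase]; simp only [subset_univ, true_and]

/-- Members of the `s`-link of a `v`-deletion (`s ≠ v`). [this work] -/
theorem mem_linkV_delV (hsv : s ≠ v) {K : Finset (Finset α)} {S : Finset α} :
    S ∈ linkV s (delV v K) ↔ s ∉ S ∧ insert s S ∈ K ∧ v ∉ S := by
  unfold delV linkV; rw [mem_filter, mem_filter, mem_powerset, subset_erase, mem_insert, not_or]
  simp only [subset_univ, true_and]
  constructor
  · rintro ⟨hsS, hK, -, hvS⟩; exact ⟨hsS, hK, hvS⟩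
  · rintro ⟨hsS, hK, hvS⟩; exact ⟨hsS, hK, fun h => hsv h.symm, hvS⟩

/-- Members of a double link (`s ≠ v`). [this work] -/
theorem mem_linkV_linkV (hsv : s ≠ v) {K : Finset (Finset α)} {S : Finset α} :
    S ∈ linkV s (linkV v K) ↔ s ∉ S ∧ v ∉ S ∧ insert v (insert s S) ∈ K := by
  unfold linkV; rw [mem_filter, mem_filter, mem_powerset, mem_powerset, subset_erase, subset_erase, mem_insert, not_or]
  simp only [subset_univ, true_and]
  constructor
  · rintro ⟨hsS, ⟨-, hvS⟩, hK⟩; exact ⟨hsS, hvS, hK⟩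
  · rintro ⟨hsS, hvS, hK⟩; exact ⟨hsS, ⟨fun h => hsv h.symm, hvS⟩, hK⟩

omit [Fintype α] in
/-- At a loop of `𝒳` every set through `s` is a member. [this work] -/
theorem insert_mem_of_loop (hF : IsUpperSet (F : Set (Finset α))) (hs : ({s} : Finset α) ∈ F) (S : Finset α) : insert s S ∈ F :=
  hF (singleton_subset_iff.2 (mem_insert_self s S)) hs

omit [Fintype α] in
/-- `v ∉ insert s S` from `s ≠ v`, `v ∉ S`. [this work] -/
theorem not_mem_insert_of_ne (hsv : s ≠ v) {S : Finset α} (hvS : v ∉ S) : v ∉ insert s S := by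
  rw [mem_insert, not_or]; exact ⟨fun h => hsv h.symm, hvS⟩

/-- Link of a deletion at a loop: `linkV s (delV v 𝒳) = delV s (delV v 2^α)`. [this work] -/
theorem linkV_delV_of_loop (hF : IsUpperSet (F : Set (Finset α))) (hs : ({s} : Finset α) ∈ F) (hsv : s ≠ v) :
    linkV s (delV v F) = delV s (delV v (univ.powerset : Finset (Finset α))) := by
  ext S; rw [mem_linkV_delV hsv, mem_delV_delV]
  have h1 := insert_mem_of_loop hF hs S
  simp only [mem_powerset, subset_univ, true_and]; tauto

/-- Link of a link at a loop: `linkV s (linkV v 𝒳) = delV s (delV v 2^α)`. [this work] -/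
theorem linkV_linkV_of_loop (hF : IsUpperSet (F : Set (Finset α))) (hs : ({s} : Finset α) ∈ F) (hsv : s ≠ v) :
    linkV s (linkV v F) = delV s (delV v (univ.powerset : Finset (Finset α))) := by
  ext S; rw [mem_linkV_linkV hsv, mem_delV_delV]
  have h1 : insert v (insert s S) ∈ F := hF (singleton_subset_iff.2 (mem_insert_of_mem (mem_insert_self s S))) hs
  simp only [mem_powerset, subset_univ, true_and]; tauto

/-- Link of the power set: `linkV s (delV v 2^α) = delV s (delV v 2^α)`. [this work] -/
theorem linkV_delV_powerset (hsv : s ≠ v) :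
    linkV s (delV v (univ.powerset : Finset (Finset α))) = delV s (delV v (univ.powerset : Finset (Finset α))) := by
  ext S; rw [mem_linkV_delV hsv, mem_delV_delV]
  simp only [mem_powerset, subset_univ, true_and]; tauto

/-- Link of the common deletions at a loop of `𝒳`: it is the link of the deletion of `𝒵`. [this work] -/
theorem linkV_delV_inter_of_loop (hF : IsUpperSet (F : Set (Finset α))) (hs : ({s} : Finset α) ∈ F) (hsv : s ≠ v) :
    linkV s (delV v F ∩ delV v G) = linkV s (delV v G) := by
  rw [← delV_inter]; ext S; rw [mem_linkV_delV hsv, mem_linkV_delV hsv, mem_inter]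
  have h1 := insert_mem_of_loop hF hs S; tauto

/-- Link of the common links at a loop of `𝒳`. [this work] -/
theorem linkV_linkV_inter_of_loop (hF : IsUpperSet (F : Set (Finset α))) (hs : ({s} : Finset α) ∈ F) (hsv : s ≠ v) :
    linkV s (linkV v F ∩ linkV v G) = linkV s (linkV v G) := by
  rw [← linkV_inter]; ext S; rw [mem_linkV_linkV hsv, mem_linkV_linkV hsv, mem_inter]
  have h1 : insert v (insert s S) ∈ F := hF (singleton_subset_iff.2 (mem_insert_of_mem (mem_insert_self s S))) hs
  tauto

/-- Sections of the size families: `linkV s (linkV v {#<3}) = delV s (delV v {#<1})`. [this work] -/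
theorem linkV_linkV_bySize (hsv : s ≠ v) :
    linkV s (linkV v (bySize (· < 3) : Finset (Finset α))) = delV s (delV v (bySize (· < 1) : Finset (Finset α))) := by
  ext S; rw [mem_linkV_linkV hsv, mem_delV_delV, mem_bySize_iff, mem_bySize_iff]
  constructor
  · rintro ⟨hsS, hvS, hc⟩
    rw [card_insert_of_notMem (not_mem_insert_of_ne hsv hvS), card_insert_of_notMem hsS] at hc
    exact ⟨⟨by omega, hvS⟩, hsS⟩
  · rintro ⟨⟨hc, hvS⟩, hsS⟩
    refine ⟨hsS, hvS, ?_⟩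
    rw [card_insert_of_notMem (not_mem_insert_of_ne hsv hvS), card_insert_of_notMem hsS]; omega

/-- `delV s (linkV v {#<3}) = delV s (delV v {#<2})`. [this work] -/
theorem delV_linkV_bySize :
    delV s (linkV v (bySize (· < 3) : Finset (Finset α))) = delV s (delV v (bySize (· < 2) : Finset (Finset α))) := by
  ext S; rw [mem_delV_linkV, mem_delV_delV, mem_bySize_iff, mem_bySize_iff]
  constructor
  · rintro ⟨⟨hvS, hc⟩, hsS⟩; rw [card_insert_of_notMem hvS] at hc; exact ⟨⟨by omega, hvS⟩, hsS⟩
  · rintro ⟨⟨hc, hvS⟩, hsS⟩; refine ⟨⟨hvS, ?_⟩, hsS⟩; rw [card_insert_of_notMem hvS]; omega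

/-- `linkV s (delV v {#<3}) = delV s (delV v {#<2})`. [this work] -/
theorem linkV_delV_bySize (hsv : s ≠ v) :
    linkV s (delV v (bySize (· < 3) : Finset (Finset α))) = delV s (delV v (bySize (· < 2) : Finset (Finset α))) := by
  ext S; rw [mem_linkV_delV hsv, mem_delV_delV, mem_bySize_iff, mem_bySize_iff]
  constructor
  · rintro ⟨hsS, hc, hvS⟩; rw [card_insert_of_notMem hsS] at hc; exact ⟨⟨by omega, hvS⟩, hsS⟩
  · rintro ⟨⟨hc, hvS⟩, hsS⟩; refine ⟨hsS, ?_, hvS⟩; rw [card_insert_of_notMem hsS]; omega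

/-- `linkV s (delV v (𝒳 ∩ {#<3})) = delV s (delV v {#<2})` at a loop `s` of `𝒳`. [this work] -/
theorem linkV_delV_filter_of_loop (hF : IsUpperSet (F : Set (Finset α))) (hs : ({s} : Finset α) ∈ F) (hsv : s ≠ v) :
    linkV s (delV v (F.filter fun S => S ∈ (bySize (· < 3) : Finset (Finset α))))
      = delV s (delV v (bySize (· < 2) : Finset (Finset α))) := by
  ext S; rw [mem_linkV_delV hsv, mem_delV_delV, mem_filter, mem_bySize_iff, mem_bySize_iff]
  have h1 := insert_mem_of_loop hF hs S
  constructor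
  · rintro ⟨hsS, ⟨-, hc⟩, hvS⟩; rw [card_insert_of_notMem hsS] at hc; exact ⟨⟨by omega, hvS⟩, hsS⟩
  · rintro ⟨⟨hc, hvS⟩, hsS⟩; refine ⟨hsS, ⟨h1, ?_⟩, hvS⟩; rw [card_insert_of_notMem hsS]; omega

/-- `linkV s (linkV v (𝒳 ∩ {#<3})) = delV s (delV v {#<1})` at a loop `s` of `𝒳`. [this work] -/
theorem linkV_linkV_filter_of_loop (hF : IsUpperSet (F : Set (Finset α))) (hs : ({s} : Finset α) ∈ F) (hsv : s ≠ v) :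
    linkV s (linkV v (F.filter fun S => S ∈ (bySize (· < 3) : Finset (Finset α))))
      = delV s (delV v (bySize (· < 1) : Finset (Finset α))) := by
  ext S; rw [mem_linkV_linkV hsv, mem_delV_delV, mem_filter, mem_bySize_iff, mem_bySize_iff]
  have h1 : insert v (insert s S) ∈ F := hF (singleton_subset_iff.2 (mem_insert_of_mem (mem_insert_self s S))) hs
  constructor
  · rintro ⟨hsS, hvS, -, hc⟩
    rw [card_insert_of_notMem (not_mem_insert_of_ne hsv hvS), card_insert_of_notMem hsS] at hc
    exact ⟨⟨by omega, hvS⟩, hsS⟩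
  · rintro ⟨⟨hc, hvS⟩, hsS⟩
    refine ⟨hsS, hvS, h1, ?_⟩
    rw [card_insert_of_notMem (not_mem_insert_of_ne hsv hvS), card_insert_of_notMem hsS]; omega

/-- `linkV s (delV v (K ∩ {#<3})) = (linkV s (delV v K)) ∩ {#<2}` (any `K`; `s ≠ v`). [this work] -/
theorem linkV_delV_filter_eq (K : Finset (Finset α)) (hsv : s ≠ v) :
    linkV s (delV v (K.filter fun S => S ∈ (bySize (· < 3) : Finset (Finset α))))
      = (linkV s (delV v K)).filter fun S => #S < 2 := by
  ext S; simp only [mem_filter, mem_linkV_delV hsv, mem_bySize_iff]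
  constructor
  · rintro ⟨hsS, ⟨hK, hc⟩, hvS⟩; rw [card_insert_of_notMem hsS] at hc; exact ⟨⟨hsS, hK, hvS⟩, by omega⟩
  · rintro ⟨⟨hsS, hK, hvS⟩, hc⟩; refine ⟨hsS, ⟨hK, ?_⟩, hvS⟩; rw [card_insert_of_notMem hsS]; omega

/-- `linkV s (linkV v (K ∩ {#<3})) = (linkV s (linkV v K)) ∩ {#<1}` (any `K`; `s ≠ v`). [this work] -/
theorem linkV_linkV_filter_eq (K : Finset (Finset α)) (hsv : s ≠ v) :
    linkV s (linkV v (K.filter fun S => S ∈ (bySize (· < 3) : Finset (Finset α))))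
      = (linkV s (linkV v K)).filter fun S => #S < 1 := by
  ext S; simp only [mem_filter, mem_linkV_linkV hsv, mem_bySize_iff]
  constructor
  · rintro ⟨hsS, hvS, hK, hc⟩
    rw [card_insert_of_notMem (not_mem_insert_of_ne hsv hvS), card_insert_of_notMem hsS] at hc
    exact ⟨⟨hsS, hvS, hK⟩, by omega⟩
  · rintro ⟨⟨hsS, hvS, hK⟩, hc⟩
    refine ⟨hsS, hvS, hK, ?_⟩
    rw [card_insert_of_notMem (not_mem_insert_of_ne hsv hvS), card_insert_of_notMem hsS]; omega

/-- The common members inside `{#<3}` at a loop of `𝒳`: their `(v,s)`-links are those of `𝒵` of size `0`. [this work] -/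
theorem linkV_linkV_inter_filter_of_loop (hF : IsUpperSet (F : Set (Finset α))) (hs : ({s} : Finset α) ∈ F) (hsv : s ≠ v) :
    linkV s (linkV v ((F ∩ G).filter fun S => S ∈ (bySize (· < 3) : Finset (Finset α))))
      = (linkV s (linkV v G)).filter fun S => #S < 1 := by
  rw [linkV_linkV_filter_eq _ hsv, linkV_inter, linkV_linkV_inter_of_loop hF hs hsv]

/-- The common members inside `{#<3}` at a loop of `𝒳`: their `(v-deletion, s-link)` sections are those of `𝒵` of size `≤ 1`. [this work] -/
theorem linkV_delV_inter_filter_of_loop (hF : IsUpperSet (F : Set (Finset α))) (hs : ({s} : Finset α) ∈ F) (hsv : s ≠ v) :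
    linkV s (delV v ((F ∩ G).filter fun S => S ∈ (bySize (· < 3) : Finset (Finset α))))
      = (linkV s (delV v G)).filter fun S => #S < 2 := by
  rw [linkV_delV_filter_eq _ hsv, delV_inter, linkV_delV_inter_of_loop hF hs hsv]

end Loop

/-! ### The loop identity -/

section Peel
variable {F G : Finset (Finset α)} {s v : α}

/-- **THE LOOP IDENTITY** (memo g43 §9.5).  `P = P₂ − P₃` the C2 difference of `R_3` at `v`, `{s} ∈ 𝒳`, `s ≠ v`; for every `s`-free `n`:
`coeff_{n+e_s} P − coeff_{n+2e_s} P = coeff_n P + coeff_n (e₁''·((Π''−X¹⁰)(Z⁰¹−Z⁰⁰) + (X¹⁰−X⁰⁰)(Z¹¹−Z¹⁰)) + e₂''·(Π''−X¹⁰)(Z¹¹−Z¹⁰))`. [this work] -/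
theorem loopPeel_identity (hF : IsUpperSet (F : Set (Finset α))) (hs : ({s} : Finset α) ∈ F) (hsv : s ≠ v)
    {n : α →₀ ℕ} (hn : n s = 0) :
    (RlumpVx (bySize (· < 3)) F G v 2 - RlumpVx (bySize (· < 3)) F G v 3).coeff (n + Finsupp.single s 1) - (RlumpVx (bySize (· < 3)) F G v 2 - RlumpVx (bySize (· < 3)) F G v 3).coeff (n + Finsupp.single s 2)
      = (RlumpVx (bySize (· < 3)) F G v 2 - RlumpVx (bySize (· < 3)) F G v 3).coeff n + ((gf (delV s (delV v (bySize (· < 2) : Finset (Finset α)))) -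
      gf (delV s (delV v (bySize (· < 1) : Finset (Finset α))))) * ((gf (delV s (delV v (univ.powerset : Finset (Finset α)))) -
      gf (delV s (linkV v F))) * (gf (linkV s (delV v G)) -gf (delV s (delV v G))) +(gf (delV s (linkV v F)) -
      gf (delV s (delV v F))) * (gf (linkV s (linkV v G)) -gf (delV s (linkV v G)))) +(gf (delV s (delV v (bySize (· < 3) : Finset (Finset α)))) -
      gf (delV s (delV v (bySize (· < 2) : Finset (Finset α))))) * ((gf (delV s (delV v (univ.powerset : Finset (Finset α)))) -
      gf (delV s (linkV v F))) * (gf (linkV s (linkV v G)) -gf (delV s (linkV v G))))).coeff n := by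
  rw [coeff_C2three_add_single_one F G v s hn, coeff_C2three_add_single_two F G v s hn, coeff_C2three_sfree F G v s hn,
    linkV_delV_inter_of_loop (G := G) hF hs hsv, linkV_linkV_inter_of_loop (G := G) hF hs hsv,
    linkV_delV_filter_of_loop hF hs hsv, linkV_linkV_filter_of_loop hF hs hsv, linkV_delV_filter_eq G hsv, linkV_linkV_filter_eq G hsv,
    linkV_linkV_inter_filter_of_loop (G := G) hF hs hsv, linkV_delV_inter_filter_of_loop (G := G) hF hs hsv,
    linkV_delV_of_loop hF hs hsv, linkV_linkV_of_loop hF hs hsv, linkV_delV_powerset hsv,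
    linkV_linkV_bySize hsv, delV_linkV_bySize, linkV_delV_bySize hsv, ← coeff_sub, ← coeff_add, loopPeel_ring]

end Peel


/-! ### Consequences: the upward peel -/

section Consequences
variable {F G : Finset (Finset α)} {s v : α}

/-- The nonnegative part of the loop identity has nonnegative coefficients (products of generating functions of set differences). [this work] -/
theorem coeff_loopPeel_rest_nonneg (hF : IsUpperSet (F : Set (Finset α))) (hG : IsUpperSet (G : Set (Finset α))) (hsv : s ≠ v) (n : α →₀ ℕ) :
    0 ≤ ((gf (delV s (delV v (bySize (· < 2) : Finset (Finset α)))) - gf (delV s (delV v (bySize (· < 1) : Finset (Finset α)))))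
            * ((gf (delV s (delV v (univ.powerset : Finset (Finset α)))) - gf (delV s (linkV v F))) * (gf (linkV s (delV v G)) - gf (delV s (delV v G)))
              + (gf (delV s (linkV v F)) - gf (delV s (delV v F))) * (gf (linkV s (linkV v G)) - gf (delV s (linkV v G))))
          + (gf (delV s (delV v (bySize (· < 3) : Finset (Finset α)))) - gf (delV s (delV v (bySize (· < 2) : Finset (Finset α)))))
            * ((gf (delV s (delV v (univ.powerset : Finset (Finset α)))) - gf (delV s (linkV v F))) * (gf (linkV s (linkV v G)) - gf (delV s (linkV v G))))).coeff n := by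
  have c01 : (delV s (delV v (bySize (· < 1) : Finset (Finset α)))) ⊆ delV s (delV v (bySize (· < 2) : Finset (Finset α))) := fun S hS => by
    rw [mem_delV_delV, mem_bySize_iff] at hS ⊢; exact ⟨⟨by omega, hS.1.2⟩, hS.2⟩
  have c12 : (delV s (delV v (bySize (· < 2) : Finset (Finset α)))) ⊆ delV s (delV v (bySize (· < 3) : Finset (Finset α))) := fun S hS => by
    rw [mem_delV_delV, mem_bySize_iff] at hS ⊢; exact ⟨⟨by omega, hS.1.2⟩, hS.2⟩
  have cXP : delV s (linkV v F) ⊆ delV s (delV v (univ.powerset : Finset (Finset α))) := fun S hS => by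
    rw [mem_delV_linkV] at hS; rw [mem_delV_delV, mem_powerset]; exact ⟨⟨subset_univ _, hS.1.1⟩, hS.2⟩
  have cX : delV s (delV v F) ⊆ delV s (linkV v F) := fun S hS => by
    rw [mem_delV_delV] at hS; rw [mem_delV_linkV]; exact ⟨⟨hS.1.2, hF (subset_insert v S) hS.1.1⟩, hS.2⟩
  have cZ0 : delV s (delV v G) ⊆ linkV s (delV v G) := fun S hS => by
    rw [mem_delV_delV] at hS; rw [mem_linkV_delV hsv]; exact ⟨hS.2, hG (subset_insert s S) hS.1.1, hS.1.2⟩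
  have cZ1 : delV s (linkV v G) ⊆ linkV s (linkV v G) := fun S hS => by
    rw [mem_delV_linkV] at hS; rw [mem_linkV_linkV hsv]
    exact ⟨hS.2, hS.1.1, hG (Finset.insert_subset_insert v (subset_insert s S)) hS.1.2⟩
  rw [gf_sub_gf_eq_gf_sdiff c01, gf_sub_gf_eq_gf_sdiff c12, gf_sub_gf_eq_gf_sdiff cXP, gf_sub_gf_eq_gf_sdiff cX, gf_sub_gf_eq_gf_sdiff cZ0,
    gf_sub_gf_eq_gf_sdiff cZ1]
  have g := fun (K : Finset (Finset α)) => coeff_gf_nonneg K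
  rw [coeff_add]
  refine add_nonneg (coeff_mul_nonneg (g _) (fun m => ?_) n) (coeff_mul_nonneg (g _) (coeff_mul_nonneg (g _) (g _)) n)
  rw [coeff_add]; exact add_nonneg (coeff_mul_nonneg (g _) (g _) m) (coeff_mul_nonneg (g _) (g _) m)


/-- **UPWARD PEEL AT A LOOP POINT** (C2-difference form).  `P = P₂ − P₃` the C2 difference of `R_3` at `v`; if `{s} ∈ 𝒳` (`s ≠ v`, `𝒳, 𝒵` up-sets), then for
every `s`-free `n`:  `coeff_{n+2e_s} P + coeff_n P ≤ coeff_{n+e_s} P`. [this work] -/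
theorem coeff_C2three_loopPeel (hF : IsUpperSet (F : Set (Finset α))) (hG : IsUpperSet (G : Set (Finset α)))
    (hs : ({s} : Finset α) ∈ F) (hsv : s ≠ v) {n : α →₀ ℕ} (hn : n s = 0) :
    (RlumpVx (bySize (· < 3)) F G v 2 - RlumpVx (bySize (· < 3)) F G v 3).coeff (n + Finsupp.single s 2) + (RlumpVx (bySize (· < 3)) F G v 2 - RlumpVx (bySize (· < 3)) F G v 3).coeff n ≤ (RlumpVx (bySize (· < 3)) F G v 2 - RlumpVx (bySize (· < 3)) F G v 3).coeff (n + Finsupp.single s 1) := by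
  have h := loopPeel_identity (G := G) hF hs hsv hn
  have h0 := coeff_loopPeel_rest_nonneg (F := F) (G := G) hF hG hsv n
  linarith

/-- **UPWARD PEEL AT A LOOP POINT** (`R_3` form).  For up-sets `𝒳, 𝒵`, a profile `m` with `m_v = 2` and `m_s = 1` where `{s} ∈ 𝒳`: writing
`C2diff(m) = coeff_m R_3 − coeff_{m+e_v} R_3` (the quantity C2 asserts to be `≥ 0`),
`C2diff(m + e_s) + C2diff(m − e_s) ≤ C2diff(m)` — the single point `s` may be DOUBLED (row `q` → row `q+1`) at the cost of the same row with one single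
point less (memo g43 §9.5). [this work] -/
theorem coeff_Rt_three_C2_loopPeel (hF : IsUpperSet (F : Set (Finset α))) (hG : IsUpperSet (G : Set (Finset α)))
    (hs : ({s} : Finset α) ∈ F) (m : α →₀ ℕ) (hv : m v = 2) (hms : m s = 1) :
    ((Rt 3 F G).coeff (m + Finsupp.single s 1) - (Rt 3 F G).coeff (m + Finsupp.single s 1 + Finsupp.single v 1))
      + ((Rt 3 F G).coeff (m - Finsupp.single s 1) - (Rt 3 F G).coeff (m - Finsupp.single s 1 + Finsupp.single v 1))
      ≤ (Rt 3 F G).coeff m - (Rt 3 F G).coeff (m + Finsupp.single v 1) := by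
  have hsv : s ≠ v := fun h => by rw [h, hv] at hms; omega
  set n := m - Finsupp.single s 1 - Finsupp.single v 2 with hn
  have hns : n s = 0 := by
    rw [hn, Finsupp.tsub_apply, Finsupp.tsub_apply, Finsupp.single_eq_same, hms]; omega
  have hnv : n v = 0 := by
    rw [hn, Finsupp.tsub_apply, Finsupp.tsub_apply, Finsupp.single_eq_same, Finsupp.single_eq_of_ne hsv.symm, hv]; rfl
  have hm : m = n + Finsupp.single s 1 + Finsupp.single v 2 := by
    ext a
    rw [Finsupp.add_apply, Finsupp.add_apply, hn, Finsupp.tsub_apply, Finsupp.tsub_apply]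
    by_cases has : a = s
    · subst has; rw [Finsupp.single_eq_same, Finsupp.single_eq_of_ne hsv, hms]; rfl
    · by_cases hav : a = v
      · subst hav; rw [Finsupp.single_eq_same, Finsupp.single_eq_of_ne has, hv]; rfl
      · rw [Finsupp.single_eq_of_ne has, Finsupp.single_eq_of_ne hav]; omega
  have hv1 : ∀ j : ℕ, (n + Finsupp.single s j) v = 0 := fun j => by
    rw [Finsupp.add_apply, hnv, Finsupp.single_eq_of_ne hsv.symm]; rfl
  have e1 : m = (n + Finsupp.single s 1) + Finsupp.single v 2 := hm
  have e2 : m + Finsupp.single v 1 = (n + Finsupp.single s 1) + Finsupp.single v 3 := by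
    rw [hm, add_assoc, ← Finsupp.single_add]
  have e3 : m + Finsupp.single s 1 = (n + Finsupp.single s 2) + Finsupp.single v 2 := by
    rw [hm, add_right_comm, add_assoc n, ← Finsupp.single_add]
  have e4 : m + Finsupp.single s 1 + Finsupp.single v 1 = (n + Finsupp.single s 2) + Finsupp.single v 3 := by
    rw [e3, add_assoc, ← Finsupp.single_add]
  have e5 : m - Finsupp.single s 1 = n + Finsupp.single v 2 := by
    rw [hm, add_right_comm, add_tsub_cancel_right]
  have e6 : m - Finsupp.single s 1 + Finsupp.single v 1 = n + Finsupp.single v 3 := by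
    rw [e5, add_assoc, ← Finsupp.single_add]
  have hv0 := hv1 2
  have hv1' := hv1 1
  rw [e4, e3, e2, e6, e5]
  conv_rhs => rw [e1]
  rw [Rt_eq_Rlump, coeff_Rlump_add_single _ F G v hv1' (by norm_num), coeff_Rlump_add_single _ F G v hv1' (by norm_num),
    coeff_Rlump_add_single _ F G v hv0 (by norm_num), coeff_Rlump_add_single _ F G v hv0 (by norm_num),
    coeff_Rlump_add_single _ F G v hnv (by norm_num), coeff_Rlump_add_single _ F G v hnv (by norm_num)]
  have key := coeff_C2three_loopPeel (G := G) hF hG hs hsv hns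
  rw [coeff_sub, coeff_sub, coeff_sub] at key
  linarith

/-- The same for a loop of `𝒵` (by the symmetry `R_3(𝒳,𝒵) = R_3(𝒵,𝒳)`). [this work] -/
theorem coeff_Rt_three_C2_loopPeel' (hF : IsUpperSet (F : Set (Finset α))) (hG : IsUpperSet (G : Set (Finset α)))
    (hs : ({s} : Finset α) ∈ G) (m : α →₀ ℕ) (hv : m v = 2) (hms : m s = 1) :
    ((Rt 3 F G).coeff (m + Finsupp.single s 1) - (Rt 3 F G).coeff (m + Finsupp.single s 1 + Finsupp.single v 1))
      + ((Rt 3 F G).coeff (m - Finsupp.single s 1) - (Rt 3 F G).coeff (m - Finsupp.single s 1 + Finsupp.single v 1))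
      ≤ (Rt 3 F G).coeff m - (Rt 3 F G).coeff (m + Finsupp.single v 1) := by
  rw [Rt_comm]; exact coeff_Rt_three_C2_loopPeel hG hF hs m hv hms

end Consequences

end Summit.CriticalPhenomena.PercolationContinuityZ3.Theorems.SahiCTCForms
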